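import Summits.QuantumFields.YangMills.Theorems.FlatTubeReductionDiagonalMomentSandwichCore
import HarnessLib

/-!
# Joint measurability of the diagonal Laplace exponent `(d, p) ↦ X(d,p)` and of its linear part `X₁(d,p)`; the Haar moments `M₂(p)`, `M_R(p)` are measurable in the fibre/gauge datum
# (route `FlatTubeReduction`, crux K1 `NearFlatRatioLaw` stmt-QuantumFields-24720; seat `ym-line-ftr-p1` g13; rate twin «ratepack-v3 / frozen fibres»; R2b1 RECORD rung — no summit
# statement is proved here)

WHY (memo `Cruxes/NearFlatRatioLaw/Lines/ratepack-v3-frozen-g12.md` §6 (F6c)).  The core+tail sandwich and `…DiagonalRatioOfLevelBounds.fpBOKernel_diag_two_sided_of_levelBounds` take the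
integrability of `ρ₁·M₂` and `ρ₁·M_R` on the core as hypotheses (`M₂(p) = ∫_d|X − X₁|`, `M_R(p) = ∫_d X²e^{|X|}`); lane A proved measurability in `d` only (`measurable_diagX_conj`,
`measurable_diagX1_conj`).  Here: joint measurability in `(d, p)`, hence (Fubini, `StronglyMeasurable.integral_prod_left'`) measurability of `M₂`, `M_R` in `p`, and a bounded-on-a-set
integrability lemma — the F6c debt of the κ_W assembly.
* `measurable_cross₂`, `measurable_dot`, `measurable_linkM`, `measurable_stiffPair` (`x ↦ ⟪D_1(w x), D′(c x)(w x)⟫`);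
* ★ `measurable_diagX_joint`, ★ `measurable_diagX1_joint`; ★★ `measurable_haarMoment2`, ★★ `measurable_haarMomentR`; `integrableOn_mul_of_bounded`.
HONEST FRAMING: measurability bookkeeping; femto rung R2b1 (RECORD label); not infinite volume, not a gap, not Clay.  No defs, no named facts, no `sorry`.
-/

set_option autoImplicit false

noncomputable section

open MeasureTheory Filter Topology Real Set
open scoped BigOperators Matrix InnerProductSpace RealInnerProductSpace
open Literature.MathematicalPhysics.QuantumFieldTheory
open Literature.MathematicalPhysics.QuantumLattice

namespace Summit.QuantumFields.YangMills.Theorems.FemtoTransferGap.RateTube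

open Summit.QuantumFields.YangMills.Theorems.FemtoTransferGap
open Summit.QuantumFields.YangMills.Theorems.FemtoTransferGap.TwoLattice
open Summit.QuantumFields.YangMills.Theorems.FemtoTransferGap.TwoLattice.ConstTube
open Summit.QuantumFields.YangMills.Theorems.FemtoTransferGap.TwoLattice.Avg
open Summit.QuantumFields.YangMills.Theorems.FemtoTransferGap.TwoLattice.Cov
open Summit.QuantumFields.YangMills.Theorems.FemtoTransferGap.TwoLattice.Toron
open Summit.QuantumFields.YangMills.Theorems.FemtoTransferGap.TwoLattice.Stiff (LinkSpace)

variable {L : ℕ} [NeZero L]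

/-! ## §1 Measurability of the building blocks (compositional — no Borel structure on the big product is used) -/

omit [NeZero L] in
/-- The cross product of measurable vector fields is measurable (componentwise polynomials). [folklore] -/
theorem measurable_cross₂ {X : Type*} [MeasurableSpace X] {a b : X → Fin 3 → ℝ} (ha : ∀ i, Measurable fun x => a x i) (hb : ∀ i, Measurable fun x => b x i) (i : Fin 3) :
    Measurable fun x => (a x ⨯₃ b x) i := by
  fin_cases i
  · simp only [cross_apply, Fin.zero_eta, Matrix.cons_val_zero]
    exact ((ha 1).mul (hb 2)).sub ((ha 2).mul (hb 1))
  · simp only [cross_apply, Fin.mk_one, Matrix.cons_val_one, Matrix.cons_val_zero]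
    exact ((ha 2).mul (hb 0)).sub ((ha 0).mul (hb 2))
  · simp only [cross_apply, Fin.reduceFinMk, Matrix.cons_val]
    exact ((ha 0).mul (hb 1)).sub ((ha 1).mul (hb 0))

omit [NeZero L] in
/-- A dot product of measurable vector fields is measurable. [folklore] -/
theorem measurable_dot {X : Type*} [MeasurableSpace X] {a b : X → Fin 3 → ℝ} (ha : ∀ i, Measurable fun x => a x i) (hb : ∀ i, Measurable fun x => b x i) :
    Measurable fun x => a x ⬝ᵥ b x := by
  simp only [dotProduct]
  exact Finset.measurable_sum _ fun i _ => (ha i).mul (hb i)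

omit [NeZero L] in
/-- `(v, v′, g) ↦ M_e = chart(v′_e)⁻¹ g_x⁻¹ chart(v_e)` is measurable in the fibre/gauge datum. [folklore] -/
theorem measurable_linkM (e : Edge 3 L) :
    Measurable fun p : (Edge 3 L → Fin 3 → ℝ) × ((Edge 3 L → Fin 3 → ℝ) × (Site 3 L → SU2)) => linkM L p.1 p.2.1 p.2.2 e := by
  haveI : SecondCountableTopology SU2 := secondCountableTopology_su2
  unfold linkM
  have h1 : Measurable fun p : (Edge 3 L → Fin 3 → ℝ) × ((Edge 3 L → Fin 3 → ℝ) × (Site 3 L → SU2)) => chartSU2 (p.2.1 e) :=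
    continuous_chartSU2.measurable.comp ((measurable_pi_apply e).comp (measurable_fst.comp measurable_snd))
  have h2 : Measurable fun p : (Edge 3 L → Fin 3 → ℝ) × ((Edge 3 L → Fin 3 → ℝ) × (Site 3 L → SU2)) => p.2.2 e.1 :=
    (measurable_pi_apply e.1).comp (measurable_snd.comp measurable_snd)
  have h3 : Measurable fun p : (Edge 3 L → Fin 3 → ℝ) × ((Edge 3 L → Fin 3 → ℝ) × (Site 3 L → SU2)) => chartSU2 (p.1 e) :=
    continuous_chartSU2.measurable.comp ((measurable_pi_apply e).comp measurable_fst)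
  exact (h1.inv.mul h2.inv).mul h3

/-- `x ↦ ⟪D_1 (w x), D′(c x) (w x)⟫` is measurable when the coordinates of `w` and `c` are. [folklore] -/
theorem measurable_stiffPair {X : Type*} [MeasurableSpace X] {c : X → Fin 3 → Fin 3 → ℝ} {w : X → LinkSpace L} (hc : ∀ k i, Measurable fun x => c x k i)
    (hw : ∀ ea : Edge 3 L × Fin 3, Measurable fun x => w x ea) :
    Measurable fun x => ⟪covCurl (1 : GaugeConfig 3 L SU2) (w x), covCurlLin (c x) (w x)⟫ := by
  have hD1 : ∀ q : Plaquette 3 L × Fin 3, Measurable fun x => covCurl (1 : GaugeConfig 3 L SU2) (w x) q := by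
    rintro ⟨⟨y, ij⟩, a⟩
    simp_rw [covCurl_one_apply]
    exact (((hw ((y, ij.1.1), a)).add (hw ((y.shift ij.1.1, ij.1.2), a))).sub (hw ((y.shift ij.1.2, ij.1.1), a))).sub (hw ((y, ij.1.2), a))
  have hDl : ∀ q : Plaquette 3 L × Fin 3, Measurable fun x => covCurlLin (c x) (w x) q := by
    rintro ⟨⟨y, ij⟩, a⟩
    simp_rw [covCurlLin_apply]
    exact (measurable_cross₂ (hc ij.1.1) (fun b => hw ((y.shift ij.1.1, ij.1.2), b)) a).sub (measurable_cross₂ (hc ij.1.2) (fun b => hw ((y.shift ij.1.2, ij.1.1), b)) a)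
  simp_rw [PiLp.inner_apply, RCLike.inner_apply, conj_trivial]
  exact Finset.measurable_sum _ fun q _ => (hDl q).mul (hD1 q)

/-! ## §2 ★ Joint measurability of the exponent and of its linear part -/

set_option maxHeartbeats 800000 in
/-- ★ `(d, p) ↦ diagX β (dud⁻¹) v v′ g` is measurable. [folklore] -/
theorem measurable_diagX_joint (β : ℝ) (u : GaugeConfig 3 1 SU2) :
    Measurable fun q : SU2 × ((Edge 3 L → Fin 3 → ℝ) × ((Edge 3 L → Fin 3 → ℝ) × (Site 3 L → SU2))) =>
      diagX L β (gaugeTransform (fun _ : Site 3 1 => q.1) u) q.2.1 q.2.2.1 q.2.2.2 := by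
  haveI : SecondCountableTopology SU2 := secondCountableTopology_su2
  have hc : Measurable fun q : SU2 × ((Edge 3 L → Fin 3 → ℝ) × ((Edge 3 L → Fin 3 → ℝ) × (Site 3 L → SU2))) => gaugeTransform (fun _ : Site 3 1 => q.1) u :=
    (measurable_constGaugeAction_left (L := 1) u).comp measurable_fst
  have hTC : Measurable fun p : GaugeConfig 3 L SU2 × GaugeConfig 3 L SU2 => timeCoupling su2Rep p.1 p.2 := (continuous_timeCoupling su2Rep continuous_su2Rep).measurable
  have hS : Measurable fun U : GaugeConfig 3 L SU2 => wilsonAction su2Rep U := (continuous_wilsonAction su2Rep continuous_su2Rep).measurable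
  have hS1 : Measurable fun U : GaugeConfig 3 1 SU2 => wilsonAction su2Rep U := (continuous_wilsonAction su2Rep continuous_su2Rep).measurable
  have hv : Measurable fun q : SU2 × ((Edge 3 L → Fin 3 → ℝ) × ((Edge 3 L → Fin 3 → ℝ) × (Site 3 L → SU2))) => q.2.1 := measurable_fst.comp measurable_snd
  have hv' : Measurable fun q : SU2 × ((Edge 3 L → Fin 3 → ℝ) × ((Edge 3 L → Fin 3 → ℝ) × (Site 3 L → SU2))) => q.2.2.1 := measurable_fst.comp (measurable_snd.comp measurable_snd)
  have hg : Measurable fun q : SU2 × ((Edge 3 L → Fin 3 → ℝ) × ((Edge 3 L → Fin 3 → ℝ) × (Site 3 L → SU2))) => q.2.2.2 := measurable_snd.comp (measurable_snd.comp measurable_snd)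
  have hTv : Measurable fun q : SU2 × ((Edge 3 L → Fin 3 → ℝ) × ((Edge 3 L → Fin 3 → ℝ) × (Site 3 L → SU2))) => orthoTube L (gaugeTransform (fun _ : Site 3 1 => q.1) u) q.2.1 := by
    have h := (measurable_orthoTube L).comp (hc.prodMk hv)
    simpa only [Function.comp_def] using h
  have hTv' : Measurable fun q : SU2 × ((Edge 3 L → Fin 3 → ℝ) × ((Edge 3 L → Fin 3 → ℝ) × (Site 3 L → SU2))) => orthoTube L (gaugeTransform (fun _ : Site 3 1 => q.1) u) q.2.2.1 := by
    have h := (measurable_orthoTube L).comp (hc.prodMk hv')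
    simpa only [Function.comp_def] using h
  have hT1v : Measurable fun q : SU2 × ((Edge 3 L → Fin 3 → ℝ) × ((Edge 3 L → Fin 3 → ℝ) × (Site 3 L → SU2))) => orthoTube L (1 : GaugeConfig 3 1 SU2) q.2.1 := by
    have h := (measurable_orthoTube_right (L := L) 1).comp hv
    simpa only [Function.comp_def] using h
  have hT1v' : Measurable fun q : SU2 × ((Edge 3 L → Fin 3 → ℝ) × ((Edge 3 L → Fin 3 → ℝ) × (Site 3 L → SU2))) => orthoTube L (1 : GaugeConfig 3 1 SU2) q.2.2.1 := by
    have h := (measurable_orthoTube_right (L := L) 1).comp hv'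
    simpa only [Function.comp_def] using h
  have hgTv' : Measurable fun q : SU2 × ((Edge 3 L → Fin 3 → ℝ) × ((Edge 3 L → Fin 3 → ℝ) × (Site 3 L → SU2))) =>
      gaugeTransform q.2.2.2 (orthoTube L (gaugeTransform (fun _ : Site 3 1 => q.1) u) q.2.2.1) := by
    have h := (measurable_gaugeAction (L := L)).comp (hTv'.prodMk hg)
    simpa only [Function.comp_def] using h
  have hgT1v' : Measurable fun q : SU2 × ((Edge 3 L → Fin 3 → ℝ) × ((Edge 3 L → Fin 3 → ℝ) × (Site 3 L → SU2))) => gaugeTransform q.2.2.2 (orthoTube L (1 : GaugeConfig 3 1 SU2) q.2.2.1) := by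
    have h := (measurable_gaugeAction (L := L)).comp (hT1v'.prodMk hg)
    simpa only [Function.comp_def] using h
  have hK : Measurable fun q : SU2 × ((Edge 3 L → Fin 3 → ℝ) × ((Edge 3 L → Fin 3 → ℝ) × (Site 3 L → SU2))) =>
      timeCoupling su2Rep (orthoTube L (gaugeTransform (fun _ : Site 3 1 => q.1) u) q.2.1) (gaugeTransform q.2.2.2 (orthoTube L (gaugeTransform (fun _ : Site 3 1 => q.1) u) q.2.2.1)) := by
    have h := hTC.comp (hTv.prodMk hgTv')
    simpa only [Function.comp_def] using h
  have hK1 : Measurable fun q : SU2 × ((Edge 3 L → Fin 3 → ℝ) × ((Edge 3 L → Fin 3 → ℝ) × (Site 3 L → SU2))) =>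
      timeCoupling su2Rep (orthoTube L (1 : GaugeConfig 3 1 SU2) q.2.1) (gaugeTransform q.2.2.2 (orthoTube L (1 : GaugeConfig 3 1 SU2) q.2.2.1)) := by
    have h := hTC.comp (hT1v.prodMk hgT1v')
    simpa only [Function.comp_def] using h
  have hSv : Measurable fun q : SU2 × ((Edge 3 L → Fin 3 → ℝ) × ((Edge 3 L → Fin 3 → ℝ) × (Site 3 L → SU2))) => wilsonAction su2Rep (orthoTube L (gaugeTransform (fun _ : Site 3 1 => q.1) u) q.2.1) := by
    have h := hS.comp hTv
    simpa only [Function.comp_def] using h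
  have hSv' : Measurable fun q : SU2 × ((Edge 3 L → Fin 3 → ℝ) × ((Edge 3 L → Fin 3 → ℝ) × (Site 3 L → SU2))) => wilsonAction su2Rep (orthoTube L (gaugeTransform (fun _ : Site 3 1 => q.1) u) q.2.2.1) := by
    have h := hS.comp hTv'
    simpa only [Function.comp_def] using h
  have hS1v : Measurable fun q : SU2 × ((Edge 3 L → Fin 3 → ℝ) × ((Edge 3 L → Fin 3 → ℝ) × (Site 3 L → SU2))) => wilsonAction su2Rep (orthoTube L (1 : GaugeConfig 3 1 SU2) q.2.1) := by
    have h := hS.comp hT1v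
    simpa only [Function.comp_def] using h
  have hS1v' : Measurable fun q : SU2 × ((Edge 3 L → Fin 3 → ℝ) × ((Edge 3 L → Fin 3 → ℝ) × (Site 3 L → SU2))) => wilsonAction su2Rep (orthoTube L (1 : GaugeConfig 3 1 SU2) q.2.2.1) := by
    have h := hS.comp hT1v'
    simpa only [Function.comp_def] using h
  have hSu : Measurable fun q : SU2 × ((Edge 3 L → Fin 3 → ℝ) × ((Edge 3 L → Fin 3 → ℝ) × (Site 3 L → SU2))) => wilsonAction su2Rep (gaugeTransform (fun _ : Site 3 1 => q.1) u) := by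
    have h := hS1.comp hc
    simpa only [Function.comp_def] using h
  have hA : Measurable fun q : SU2 × ((Edge 3 L → Fin 3 → ℝ) × ((Edge 3 L → Fin 3 → ℝ) × (Site 3 L → SU2))) =>
      β * (timeCoupling su2Rep (orthoTube L (gaugeTransform (fun _ : Site 3 1 => q.1) u) q.2.1) (gaugeTransform q.2.2.2 (orthoTube L (gaugeTransform (fun _ : Site 3 1 => q.1) u) q.2.2.1)) -
        timeCoupling su2Rep (orthoTube L (1 : GaugeConfig 3 1 SU2) q.2.1) (gaugeTransform q.2.2.2 (orthoTube L (1 : GaugeConfig 3 1 SU2) q.2.2.1))) := (hK.sub hK1).const_mul β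
  have hB : Measurable fun q : SU2 × ((Edge 3 L → Fin 3 → ℝ) × ((Edge 3 L → Fin 3 → ℝ) × (Site 3 L → SU2))) =>
      β / 2 * ((wilsonAction su2Rep (orthoTube L (gaugeTransform (fun _ : Site 3 1 => q.1) u) q.2.1) - (L : ℝ) ^ 3 * wilsonAction su2Rep (gaugeTransform (fun _ : Site 3 1 => q.1) u)) -
        wilsonAction su2Rep (orthoTube L (1 : GaugeConfig 3 1 SU2) q.2.1)) := ((hSv.sub (hSu.const_mul _)).sub hS1v).const_mul _
  have hC : Measurable fun q : SU2 × ((Edge 3 L → Fin 3 → ℝ) × ((Edge 3 L → Fin 3 → ℝ) × (Site 3 L → SU2))) =>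
      β / 2 * ((wilsonAction su2Rep (orthoTube L (gaugeTransform (fun _ : Site 3 1 => q.1) u) q.2.2.1) - (L : ℝ) ^ 3 * wilsonAction su2Rep (gaugeTransform (fun _ : Site 3 1 => q.1) u)) -
        wilsonAction su2Rep (orthoTube L (1 : GaugeConfig 3 1 SU2) q.2.2.1)) := ((hSv'.sub (hSu.const_mul _)).sub hS1v').const_mul _
  unfold diagX
  exact (hA.sub hB).sub hC

set_option maxHeartbeats 800000 in
/-- ★ `(d, p) ↦ diagX1 β (slowLin (dud⁻¹)) v v′ g` is measurable (indeed continuous). [folklore] -/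
theorem measurable_diagX1_joint (β : ℝ) (u : GaugeConfig 3 1 SU2) :
    Measurable fun q : SU2 × ((Edge 3 L → Fin 3 → ℝ) × ((Edge 3 L → Fin 3 → ℝ) × (Site 3 L → SU2))) =>
      diagX1 L β (slowLin (gaugeTransform (fun _ : Site 3 1 => q.1) u)) q.2.1 q.2.2.1 q.2.2.2 := by
  haveI : SecondCountableTopology SU2 := secondCountableTopology_su2
  simp_rw [diagX1_slowLin_conj]
  -- coordinates of the colour vectors, of the fibres and of the gauge field
  have hck : ∀ (k : Fin 3) (i : Fin 3), Measurable fun q : SU2 × ((Edge 3 L → Fin 3 → ℝ) × ((Edge 3 L → Fin 3 → ℝ) × (Site 3 L → SU2))) => ((adRot q.1).mulVec (slowLin u k)) i := by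
    intro k i
    have h := ((continuous_apply i).comp (continuous_adRot_mulVec (slowLin u k))).measurable.comp
      (measurable_fst : Measurable fun q : SU2 × ((Edge 3 L → Fin 3 → ℝ) × ((Edge 3 L → Fin 3 → ℝ) × (Site 3 L → SU2))) => q.1)
    simpa only [Function.comp_def] using h
  have hp : Measurable fun q : SU2 × ((Edge 3 L → Fin 3 → ℝ) × ((Edge 3 L → Fin 3 → ℝ) × (Site 3 L → SU2))) => q.2 := measurable_snd
  have hvp : Measurable (vecPart : SU2 → Fin 3 → ℝ) := continuous_vecPart.measurable
  have hgy : ∀ (e : Edge 3 L) (i : Fin 3), Measurable fun q : SU2 × ((Edge 3 L → Fin 3 → ℝ) × ((Edge 3 L → Fin 3 → ℝ) × (Site 3 L → SU2))) => vecPart (q.2.2.2 (e.1.shift e.2)) i := by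
    intro e i
    have hge : Measurable fun q : SU2 × ((Edge 3 L → Fin 3 → ℝ) × ((Edge 3 L → Fin 3 → ℝ) × (Site 3 L → SU2))) => q.2.2.2 (e.1.shift e.2) :=
      (measurable_pi_apply _).comp (measurable_snd.comp (measurable_snd.comp measurable_snd))
    have h := (measurable_pi_apply i).comp (hvp.comp hge)
    simpa only [Function.comp_def] using h
  have hM : ∀ (e : Edge 3 L) (i : Fin 3), Measurable fun q : SU2 × ((Edge 3 L → Fin 3 → ℝ) × ((Edge 3 L → Fin 3 → ℝ) × (Site 3 L → SU2))) => vecPart (linkM L q.2.1 q.2.2.1 q.2.2.2 e) i := by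
    intro e i
    have hle : Measurable fun q : SU2 × ((Edge 3 L → Fin 3 → ℝ) × ((Edge 3 L → Fin 3 → ℝ) × (Site 3 L → SU2))) => linkM L q.2.1 q.2.2.1 q.2.2.2 e := by
      have h := (measurable_linkM (L := L) e).comp hp
      simpa only [Function.comp_def] using h
    have h := (measurable_pi_apply i).comp (hvp.comp hle)
    simpa only [Function.comp_def] using h
  have hkin : Measurable fun q : SU2 × ((Edge 3 L → Fin 3 → ℝ) × ((Edge 3 L → Fin 3 → ℝ) × (Site 3 L → SU2))) =>
      ∑ e : Edge 3 L, (adRot q.1).mulVec (slowLin u e.2) ⬝ᵥ (vecPart (q.2.2.2 (e.1.shift e.2)) ⨯₃ vecPart (linkM L q.2.1 q.2.2.1 q.2.2.2 e)) :=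
    Finset.measurable_sum _ fun e _ => measurable_dot (hck e.2) (measurable_cross₂ (hgy e) (hM e))
  have hw : ∀ ea : Edge 3 L × Fin 3, Measurable fun q : SU2 × ((Edge 3 L → Fin 3 → ℝ) × ((Edge 3 L → Fin 3 → ℝ) × (Site 3 L → SU2))) => linkEmbed L q.2.1 ea := fun ea => by
    have h := (measurable_pi_apply ea.2).comp ((measurable_pi_apply ea.1).comp
      (measurable_fst.comp (measurable_snd : Measurable fun q : SU2 × ((Edge 3 L → Fin 3 → ℝ) × ((Edge 3 L → Fin 3 → ℝ) × (Site 3 L → SU2))) => q.2)))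
    simpa only [Function.comp_def, linkEmbed_apply] using h
  have hw' : ∀ ea : Edge 3 L × Fin 3, Measurable fun q : SU2 × ((Edge 3 L → Fin 3 → ℝ) × ((Edge 3 L → Fin 3 → ℝ) × (Site 3 L → SU2))) => linkEmbed L q.2.2.1 ea := fun ea => by
    have h := (measurable_pi_apply ea.2).comp ((measurable_pi_apply ea.1).comp
      (measurable_fst.comp (measurable_snd.comp (measurable_snd : Measurable fun q : SU2 × ((Edge 3 L → Fin 3 → ℝ) × ((Edge 3 L → Fin 3 → ℝ) × (Site 3 L → SU2))) => q.2))))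
    simpa only [Function.comp_def, linkEmbed_apply] using h
  have hmag := measurable_stiffPair (L := L) (X := SU2 × ((Edge 3 L → Fin 3 → ℝ) × ((Edge 3 L → Fin 3 → ℝ) × (Site 3 L → SU2))))
    (c := fun q k => (adRot q.1).mulVec (slowLin u k)) (w := fun q => linkEmbed L q.2.1) hck hw
  have hmag' := measurable_stiffPair (L := L) (X := SU2 × ((Edge 3 L → Fin 3 → ℝ) × ((Edge 3 L → Fin 3 → ℝ) × (Site 3 L → SU2))))
    (c := fun q k => (adRot q.1).mulVec (slowLin u k)) (w := fun q => linkEmbed L q.2.2.1) hck hw'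
  unfold diagX1
  show Measurable fun q : SU2 × ((Edge 3 L → Fin 3 → ℝ) × ((Edge 3 L → Fin 3 → ℝ) × (Site 3 L → SU2))) =>
      β * -(2 * ∑ e : Edge 3 L, (adRot q.1).mulVec (slowLin u e.2) ⬝ᵥ (vecPart (q.2.2.2 (e.1.shift e.2)) ⨯₃ vecPart (linkM L q.2.1 q.2.2.1 q.2.2.2 e))) -
      β / 2 * (2 * ⟪covCurl (1 : GaugeConfig 3 L SU2) (linkEmbed L q.2.1), covCurlLin (fun k => (adRot q.1).mulVec (slowLin u k)) (linkEmbed L q.2.1)⟫) -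
      β / 2 * (2 * ⟪covCurl (1 : GaugeConfig 3 L SU2) (linkEmbed L q.2.2.1), covCurlLin (fun k => (adRot q.1).mulVec (slowLin u k)) (linkEmbed L q.2.2.1)⟫)
  exact ((measurable_const.mul (measurable_const.mul hkin).neg).sub (measurable_const.mul (measurable_const.mul hmag))).sub
    (measurable_const.mul (measurable_const.mul hmag'))

/-! ## §3 ★★ The Haar moments are measurable in the fibre/gauge datum -/

/-- ★★ `p ↦ M₂(p) = ∫_d |X(d,p) − X₁(d,p)|` is measurable. [folklore] -/
theorem measurable_haarMoment2 (β : ℝ) (u : GaugeConfig 3 1 SU2) :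
    Measurable fun p : (Edge 3 L → Fin 3 → ℝ) × ((Edge 3 L → Fin 3 → ℝ) × (Site 3 L → SU2)) =>
      ∫ d, |diagX L β (gaugeTransform (fun _ : Site 3 1 => d) u) p.1 p.2.1 p.2.2 - diagX1 L β (slowLin (gaugeTransform (fun _ : Site 3 1 => d) u)) p.1 p.2.1 p.2.2| ∂haarProbability SU2 := by
  haveI : SecondCountableTopology SU2 := secondCountableTopology_su2
  have h := ((measurable_diagX_joint (L := L) β u).sub (measurable_diagX1_joint (L := L) β u)).abs.stronglyMeasurable
  exact (h.integral_prod_left' (μ := haarProbability SU2)).measurable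

/-- ★★ `p ↦ M_R(p) = ∫_d X(d,p)²·e^{|X(d,p)|}` is measurable. [folklore] -/
theorem measurable_haarMomentR (β : ℝ) (u : GaugeConfig 3 1 SU2) :
    Measurable fun p : (Edge 3 L → Fin 3 → ℝ) × ((Edge 3 L → Fin 3 → ℝ) × (Site 3 L → SU2)) =>
      ∫ d, diagX L β (gaugeTransform (fun _ : Site 3 1 => d) u) p.1 p.2.1 p.2.2 ^ 2 * Real.exp |diagX L β (gaugeTransform (fun _ : Site 3 1 => d) u) p.1 p.2.1 p.2.2| ∂haarProbability SU2 := by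
  haveI : SecondCountableTopology SU2 := secondCountableTopology_su2
  have hX := measurable_diagX_joint (L := L) β u
  have h := ((hX.pow_const 2).mul (Real.measurable_exp.comp hX.abs)).stronglyMeasurable
  exact (h.integral_prod_left' (μ := haarProbability SU2)).measurable

/-! ## §4 Integrability on a set from a bound -/

omit [NeZero L] in
/-- On a finite measure: `ρ` measurable with `|ρ| ≤ B`, `M` measurable with `0 ≤ M ≤ C` on the measurable set `S` ⇒ `ρ·M` is integrable on `S`. [folklore] -/
theorem integrableOn_mul_of_bounded {X : Type*} [MeasurableSpace X] {μ : Measure X} [IsFiniteMeasure μ] {ρ M : X → ℝ} (hρm : Measurable ρ) (hMm : Measurable M)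
    {B C : ℝ} (hB : 0 ≤ B) (hρ : ∀ x, |ρ x| ≤ B) {S : Set X} (hS : MeasurableSet S) (hM0 : ∀ x ∈ S, 0 ≤ M x) (hMC : ∀ x ∈ S, M x ≤ C) :
    IntegrableOn (fun x => ρ x * M x) S μ := by
  refine Measure.integrableOn_of_bounded (M := B * C) (measure_ne_top _ _) ((hρm.mul hMm).aestronglyMeasurable) ?_
  refine (ae_restrict_iff' hS).mpr (ae_of_all _ fun x hx => ?_)
  rw [norm_mul, Real.norm_eq_abs, Real.norm_eq_abs, abs_of_nonneg (hM0 x hx)]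
  exact mul_le_mul (hρ x) (hMC x hx) (hM0 x hx) hB

end Summit.QuantumFields.YangMills.Theorems.FemtoTransferGap.RateTube

end
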